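import Summits.Ventures.PercRepro.SixFourT4XA

/-!
# PercRepro — C-025 at `(6,4)`, §22.4(a) IN THE KERNEL: `X ≤ Σ_ρ Ξ_g(ρ)` for generic `G` (p3, gen 8)

With part A (`SixFourT4XA.lean`): `X = Σ_ψ #fiber ψ`, `#fiber ψ ≤ 2^{|λ_ψ|}`, `#fiber ψ = #fiber (partner ψ)`,
`|λ_ψ| = |ψ ∩ G| + |partner ψ ∩ G| − g`, and `λ_ψ` is `∅`, a point or a full line trace.  Here the fibres are charged
to the LARGER plane of each partner pair (`Σ_B f ≤ Σ_A f` via `partner`, an involution on the planes with nonempty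
fibre), and for the larger plane `2·#fiber ψ ≤ 2^{|λ_ψ| + 1} ≤ 2^{1 + λ_max} = Ξ_g(ψ)` in profile form
(`two_mul_card_fiber_le_xiProf`; `|λ_ψ| ≤ min(2p − g, 7 + p − g)` because `p′ ≤ p ≤ 7`).  Main result:
`Xcnt_le_sum_xiProf` — for every generic `G` with `g ≥ 10` and all plane traces `≤ 7` points,
`X ≤ Σ_{P ∈ planes M} xiProf g |P ∩ G| (inc …)`.
-/

namespace PercRepro.SixFour

open Finset ThmH

variable {α : Type*} [DecidableEq α] {M : Matroid α} [M.Finite] {G : Finset α}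

/-! ## The profile `λ_max` dominates every admissible `λ` -/

/-- Every admissible `s` (`s ≤ 1`, or `2 ≤ s ≤ 6` with `inc_s ≥ 1`) with `s ≤ min(2p − g, 7 + p − g)` is at most
`lamMax`. -/
theorem le_lamMax (g p i2 i3 i4 i5 i6 s : ℕ) (hs6 : s ≤ 6)
    (hadm : s ≤ 1 ∨ (s = 2 ∧ 1 ≤ i2) ∨ (s = 3 ∧ 1 ≤ i3) ∨ (s = 4 ∧ 1 ≤ i4) ∨ (s = 5 ∧ 1 ≤ i5) ∨ (s = 6 ∧ 1 ≤ i6))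
    (hb : s ≤ min (2 * p - g) (7 + p - g)) : s ≤ lamMax g p i2 i3 i4 i5 i6 := by
  unfold lamMax
  simp only
  split_ifs <;> omega

/-- The admissible sizes of `λ_ψ` from `lambda_line`, in the form `le_lamMax` wants. -/
theorem lambda_admissible (hs : Simple M) (hG : G ⊆ gr M) (hr : M.eRk (G : Set α) = 4) (hgen : Generic M G)
    {P : Finset α} (hP : P ∈ planes M) (hne : (fiber M G P).Nonempty) (h6 : (lambda M G P).card ≤ 6) :
    (lambda M G P).card ≤ 1 ∨ ((lambda M G P).card = 2 ∧ 1 ≤ inc M (P ∩ G) 2) ∨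
      ((lambda M G P).card = 3 ∧ 1 ≤ inc M (P ∩ G) 3) ∨ ((lambda M G P).card = 4 ∧ 1 ≤ inc M (P ∩ G) 4) ∨
      ((lambda M G P).card = 5 ∧ 1 ≤ inc M (P ∩ G) 5) ∨ ((lambda M G P).card = 6 ∧ 1 ≤ inc M (P ∩ G) 6) := by
  rcases lambda_line hs hG hr hgen hP hne with h | h
  · exact Or.inl h
  · have : (lambda M G P).card = 2 ∨ (lambda M G P).card = 3 ∨ (lambda M G P).card = 4 ∨
        (lambda M G P).card = 5 ∨ (lambda M G P).card = 6 ∨ (lambda M G P).card ≤ 1 := by omega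
    rcases this with h2 | h3 | h4 | h5 | h6' | h1
    · right; left; exact ⟨h2, by rwa [h2] at h⟩
    · right; right; left; exact ⟨h3, by rwa [h3] at h⟩
    · right; right; right; left; exact ⟨h4, by rwa [h4] at h⟩
    · right; right; right; right; left; exact ⟨h5, by rwa [h5] at h⟩
    · right; right; right; right; right; exact ⟨h6', by rwa [h6'] at h⟩
    · exact Or.inl h1

/-! ## The larger plane of a pair pays `Ξ_g` -/

/-- For a plane `ψ` at least as large as its partner: `2·#fiber ψ ≤ Ξ_g(ψ)` (profile form). -/
theorem two_mul_card_fiber_le_xiProf (hs : Simple M) (hG : G ⊆ gr M) (hr : M.eRk (G : Set α) = 4)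
    (hgen : Generic M G) (hpl : ∀ P ∈ planes M, (P ∩ G).card ≤ 7) (hg : 10 ≤ G.card) {P : Finset α}
    (hP : P ∈ planes M) (hlarge : (partner M G P ∩ G).card ≤ (P ∩ G).card) :
    2 * (fiber M G P).card ≤ xiProf G.card (P ∩ G).card (inc M (P ∩ G) 2) (inc M (P ∩ G) 3) (inc M (P ∩ G) 4)
      (inc M (P ∩ G) 5) (inc M (P ∩ G) 6) := by
  by_cases hne : (fiber M G P).Nonempty
  · have hfl := card_fiber_le hG hr hgen hP
    have hlam := card_lambda hG hr hgen hP hne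
    have hp7 := hpl P hP
    have hp'7 : (partner M G P ∩ G).card ≤ 7 := by
      obtain ⟨Z, hZ⟩ := hne
      exact hpl _ (fiber_facts hG hr hgen hP hZ).2.1
    have h6 : (lambda M G P).card ≤ 6 := by omega
    have hadm := lambda_admissible hs hG hr hgen hP hne h6
    have hb : (lambda M G P).card ≤ min (2 * (P ∩ G).card - G.card) (7 + (P ∩ G).card - G.card) := by
      rw [Nat.le_min]; omega
    have hle := le_lamMax G.card (P ∩ G).card (inc M (P ∩ G) 2) (inc M (P ∩ G) 3) (inc M (P ∩ G) 4)
      (inc M (P ∩ G) 5) (inc M (P ∩ G) 6) (lambda M G P).card h6 hadm hb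
    unfold xiProf
    rw [if_neg (by omega)]
    calc 2 * (fiber M G P).card ≤ 2 * 2 ^ (lambda M G P).card := by omega
      _ = 2 ^ ((lambda M G P).card + 1) := by ring
      _ ≤ 2 ^ (1 + lamMax G.card (P ∩ G).card (inc M (P ∩ G) 2) (inc M (P ∩ G) 3) (inc M (P ∩ G) 4)
          (inc M (P ∩ G) 5) (inc M (P ∩ G) 6)) := Nat.pow_le_pow_right (by norm_num) (by omega)
  · rw [Finset.not_nonempty_iff_eq_empty] at hne
    rw [hne, Finset.card_empty, mul_zero]
    exact Nat.zero_le _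

/-! ## Charging the fibres to the larger plane: `X ≤ Σ_ρ Ξ_g(ρ)` -/

/-- The planes strictly smaller than their partner contribute at most the larger planes do. -/
theorem sum_fiber_small_le (hG : G ⊆ gr M) (hr : M.eRk (G : Set α) = 4) (hgen : Generic M G) :
    ∑ P ∈ (planes M).filter (fun P : Finset α => ¬ (partner M G P ∩ G).card ≤ (P ∩ G).card), (fiber M G P).card ≤
      ∑ P ∈ (planes M).filter (fun P : Finset α => (partner M G P ∩ G).card ≤ (P ∩ G).card), (fiber M G P).card := by
  set B := (planes M).filter (fun P : Finset α => ¬ (partner M G P ∩ G).card ≤ (P ∩ G).card) with hB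
  set A := (planes M).filter (fun P : Finset α => (partner M G P ∩ G).card ≤ (P ∩ G).card) with hA
  set B' := B.filter (fun P : Finset α => (fiber M G P).Nonempty) with hB'
  -- drop the planes with empty fibre
  have h1 : ∑ P ∈ B, (fiber M G P).card = ∑ P ∈ B', (fiber M G P).card :=
    (Finset.sum_filter_of_ne (fun P _ hne => Finset.card_pos.1 (Nat.pos_of_ne_zero hne))).symm
  -- on `B'` the fibre equals the partner's fibre, and `partner` maps `B'` injectively into `A`
  have h2 : ∑ P ∈ B', (fiber M G P).card = ∑ P ∈ B', (fiber M G (partner M G P)).card := by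
    refine Finset.sum_congr rfl (fun P hP => ?_)
    rw [hB', Finset.mem_filter, hB, Finset.mem_filter] at hP
    exact (card_fiber_partner hG hr hgen hP.1.1 hP.2).symm
  have hinj : Set.InjOn (fun P => partner M G P) (B' : Set (Finset α)) := by
    intro P₁ hP₁ P₂ hP₂ heq
    rw [Finset.mem_coe, hB', Finset.mem_filter, hB, Finset.mem_filter] at hP₁ hP₂
    have e₁ := partner_partner hG hr hgen hP₁.1.1 hP₁.2
    have e₂ := partner_partner hG hr hgen hP₂.1.1 hP₂.2
    have heq' : partner M G P₁ = partner M G P₂ := heq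
    rw [← e₁, ← e₂, heq']
  have hmaps : B'.image (fun P => partner M G P) ⊆ A := by
    intro Q hQ
    obtain ⟨P, hP, rfl⟩ := Finset.mem_image.1 hQ
    rw [hB', Finset.mem_filter, hB, Finset.mem_filter] at hP
    obtain ⟨⟨hPpl, hsmall⟩, hne⟩ := hP
    obtain ⟨Z, hZ⟩ := hne
    have hP' := (fiber_facts hG hr hgen hPpl hZ).2.1
    rw [hA, Finset.mem_filter]
    refine ⟨hP', ?_⟩
    rw [partner_partner hG hr hgen hPpl ⟨Z, hZ⟩]
    omega
  have h3 := Finset.sum_image (s := B') (g := fun P => partner M G P) (f := fun P => (fiber M G P).card) hinj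
  rw [h1, h2, ← h3]
  exact Finset.sum_le_sum_of_subset_of_nonneg hmaps (fun _ _ _ => Nat.zero_le _)

/-- A plane with nonempty fibre has a rank-`3` trace. -/
theorem eRk_trace_eq_three_of_fiber_nonempty (hG : G ⊆ gr M) (hr : M.eRk (G : Set α) = 4) (hgen : Generic M G)
    {P : Finset α} (hP : P ∈ planes M) (hne : (fiber M G P).Nonempty) : M.eRk ((P ∩ G : Finset α) : Set α) = 3 := by
  obtain ⟨Z, hZ⟩ := hne
  obtain ⟨hZsub, -, -, -, -⟩ := fiber_facts hG hr hgen hP hZ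
  have hZ3 := eRk_eq_three_of_mem_Xset hG hr hgen (Finset.mem_filter.1 hZ).1
  refine le_antisymm ?_ (by rw [← hZ3]; exact M.eRk_mono (Finset.coe_subset.2 hZsub))
  rw [← (mem_planes.1 hP).2.2]
  exact M.eRk_mono (Finset.coe_subset.2 Finset.inter_subset_left)

/-- **§22.4(a) in profile form**: for a generic `G` with `g ≥ 10` points and all plane traces `≤ 7` points,
`X ≤ Σ_{P ∈ planes M, r(P ∩ G) = 3} Ξ_g(P ∩ G)`. -/
theorem Xcnt_le_sum_xiProf (hs : Simple M) (hG : G ⊆ gr M) (hr : M.eRk (G : Set α) = 4) (hgen : Generic M G)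
    (hpl : ∀ P ∈ planes M, (P ∩ G).card ≤ 7) (hg : 10 ≤ G.card) :
    Xcnt M G ≤ ∑ P ∈ (planes M).filter (fun P : Finset α => M.eRk ((P ∩ G : Finset α) : Set α) = 3),
      xiProf G.card (P ∩ G).card (inc M (P ∩ G) 2) (inc M (P ∩ G) 3) (inc M (P ∩ G) 4) (inc M (P ∩ G) 5)
        (inc M (P ∩ G) 6) := by
  rw [Xcnt_eq_card_Xset, card_Xset_eq_sum_fiber hG hr hgen]
  rw [← Finset.sum_filter_add_sum_filter_not (planes M)
    (fun P : Finset α => (partner M G P ∩ G).card ≤ (P ∩ G).card) (fun P => (fiber M G P).card)]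
  have hsmall := sum_fiber_small_le hG hr hgen
  set A := (planes M).filter (fun P : Finset α => (partner M G P ∩ G).card ≤ (P ∩ G).card) with hA
  set A' := A.filter (fun P : Finset α => (fiber M G P).Nonempty) with hA'
  -- the larger planes with empty fibre contribute nothing
  have h1 : ∑ P ∈ A, (fiber M G P).card = ∑ P ∈ A', (fiber M G P).card :=
    (Finset.sum_filter_of_ne (fun P _ hne => Finset.card_pos.1 (Nat.pos_of_ne_zero hne))).symm
  have hlarge : ∑ P ∈ A', 2 * (fiber M G P).card ≤ ∑ P ∈ A',
      xiProf G.card (P ∩ G).card (inc M (P ∩ G) 2) (inc M (P ∩ G) 3) (inc M (P ∩ G) 4) (inc M (P ∩ G) 5)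
        (inc M (P ∩ G) 6) :=
    Finset.sum_le_sum (fun P hP => by
      rw [hA', Finset.mem_filter, hA, Finset.mem_filter] at hP
      exact two_mul_card_fiber_le_xiProf hs hG hr hgen hpl hg hP.1.1 hP.1.2)
  rw [← Finset.mul_sum] at hlarge
  have hsub : A' ⊆ (planes M).filter (fun P : Finset α => M.eRk ((P ∩ G : Finset α) : Set α) = 3) := by
    intro P hP
    rw [hA', Finset.mem_filter, hA, Finset.mem_filter] at hP
    rw [Finset.mem_filter]
    exact ⟨hP.1.1, eRk_trace_eq_three_of_fiber_nonempty hG hr hgen hP.1.1 hP.2⟩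
  have hsub' := Finset.sum_le_sum_of_subset_of_nonneg hsub
    (f := fun P => xiProf G.card (P ∩ G).card (inc M (P ∩ G) 2) (inc M (P ∩ G) 3) (inc M (P ∩ G) 4)
      (inc M (P ∩ G) 5) (inc M (P ∩ G) 6)) (fun _ _ _ => Nat.zero_le _)
  omega

end PercRepro.SixFour
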